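import Literature.AlgebraicGeometry.HilbertScheme.HeisenbergMonomialSpanning
import Literature.AlgebraicGeometry.HilbertScheme.PoincareCasimirElement
import HarnessLib

/-!
# The Heisenberg monomials are LINEARLY INDEPENDENT — the Nakajima–Grojnowski basis theorem PROVED from the axioms;
# discharge of the named fact `Nakajima1997_heisenbergMonomialBasis`

Layer `Literature/AlgebraicGeometry/HilbertScheme`; sequel of `HeisenbergMonomialSpanning` (the spanning conjunct).
This file PROVES the linear-independence conjunct of `Nakajima1997_heisenbergMonomialBasis` (file
`HeisenbergMonomialBasis`) for EVERY representation satisfying the tree's axioms `IsHeisenbergRepresentation` over a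
field of characteristic zero whose pairing admits a homogeneous DUAL FAMILY `y` to the homogeneous family `x`
(`⟨y_c, x_{c'}⟩ = δ_{cc'}`), and then discharges the named fact on the tree's carriers, where the dual family comes
from the Casimir element of the Poincaré pairing (`PoincareCasimirElement.exists_isCasimir_mem_evenTensorSpan`,
Poincaré duality):

* `IsHeisenbergRepresentation.annihilator_apply_letterMonomial_vac` — **the annihilation operator `𝔮₋ₘ(y_c)` acts on a
  sorted admissible monomial `Π 𝔮_{rⱼ}(x_{cⱼ})|0⟩` as a (super-)derivation**: it removes one copy of the letter `(c, m)`,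
  with coefficient `± (−m) · #{j : (cⱼ, rⱼ) = (c, m)}` (and gives `0` if the letter is absent);
* `IsHeisenbergRepresentation.linearIndependent_letterMonomial_vac` — the sorted admissible monomials applied to
  `|0⟩` are linearly independent (induction on the total mode: apply `𝔮₋ₘ(y_c)` for a letter `(c, m)` of a word with a
  non-zero coefficient; a sorted word is determined by its erasure);
* `IsHeisenbergRepresentation.linearIndependent_heisenbergMonomial` — re-indexed by `ρ ∈ 𝒫ₙ`;
* `IsCasimir.exists_left_dual` — a Casimir element `Σ eᵢ ⊗ εᵢ` of `B` represents every functional `φ` on the left: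
  `⟨Σᵢ φ(εᵢ) eᵢ, v⟩ = φ(v)`;
* `NakajimaOperators.linearIndependent_heisenbergMonomial`, `NakajimaOperators.heisenbergMonomial_basis` and the
  DISCHARGE `Nakajima1997_heisenbergMonomialBasis_holds : Nakajima1997_heisenbergMonomialBasis` (net debt −1; placed in
  this sibling file because the proof imports the fact's file).

THE PRINTED ARGUMENT (Lehn, Invent. Math. 136 (1999), Cor. 2.6 and its proof: "`S*W₊ → ℍ, P ↦ P·|0⟩` is a
homomorphism of `W`-modules if we let `W₋` act on `S*W₊` by derivations … since `ℍ` is irreducible, it is an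
isomorphism"; Nakajima, Ann. of Math. 145 (1997) §8 / Thm. 1.2 (the Heisenberg relations + Göttsche's formula); LQW,
J. reine angew. Math. 554 (2003) §6 pp. 13–14: "the Heisenberg monomials `Π_{c∈S} 𝔞_{−ρ(c)}(c)·|0⟩`, `ρ ∈ 𝒫ₙ(S)`, are
linearly independent"): the annihilation operators `𝔞ₘ = 𝔮₋ₘ(y)`, `m > 0`, kill `|0⟩` (bi-degree) and act on creation
monomials as derivations (`[𝔮₋ₘ(y), 𝔮ᵣ(x)} = δ_{m,r} (−m)⟨y, x⟩`); with `y_c` dual to `x_c` the operator `𝔮₋ₘ(y_c)` lowers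
the multiplicity of the letter `(c, m)` by one with a non-zero coefficient (characteristic zero; for odd `x_c` the
multiplicity is `≤ 1` and the super-signs cannot cancel), so a non-trivial relation of minimal total mode yields a
smaller one.

## References

* M. Lehn, Invent. Math. 136 (1999) 157–207 [`Lehn1999`], Thm. 2.5, Cor. 2.6 and proof (p. 8), §3.1 (the adjoint of
  the cup product).
* H. Nakajima, Ann. of Math. 145 (1997) 379–388 [`Nakajima1997`], Thm. 1.2 / §8; I. Grojnowski, Math. Res. Lett. 3
  (1996) 275–291 [`Grojnowski1996`], Thm. 1.
* W.-P. Li, Z. Qin, W. Wang, J. reine angew. Math. 554 (2003) [`LiQinWang2003`], §6 pp. 13–14; Math. Ann. 324 (2002)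
  [`LiQinWang2002`], §2 p. 5.

HONEST FRAMING: nothing here asserts L1 / `LefschetzGenerationHilb n` / MODEL_X / HC_Kum4Type / HC.
-/

noncomputable section

open DirectSum TensorProduct

universe u v w

namespace Literature.AlgebraicGeometry.HilbertScheme

/-! ### 1. The annihilation operator `𝔮₋ₘ(y_c)` on sorted admissible monomials -/

section Annihilation

variable {K : Type u} [Field K]
variable {A : ℕ → Type v} [∀ i, AddCommGroup (A i)] [∀ i, Module K (A i)]
variable {Φ : ℕ → ℕ → Type w} [∀ n i, AddCommGroup (Φ n i)] [∀ n i, Module K (Φ n i)]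
variable {B : (⨁ i, A i) →ₗ[K] (⨁ i, A i) →ₗ[K] K} {q : ℤ → (⨁ i, A i) →ₗ[K] Module.End K (Fock Φ)} {vac : Fock Φ}
variable {N : ℕ} {x y : Fin N → ⨁ i, A i} {deg codeg : Fin N → ℕ}

variable (K) in
/-- The coefficient with which `𝔮₋ₘ(y_c)` acts on the monomial of a sorted admissible word `L`: the super-sign of
moving past the letters `< (c, m)`, times `(−m)`, times the multiplicity of the letter `(c, m)` in `L`.
[cite: Lehn1999, Thm. 2.5 and proof of Cor. 2.6] -/
def annCoef (deg codeg : Fin N → ℕ) (c : Fin N) (m : ℕ) (L : List (Lex (Fin N × ℕ))) : K :=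
  (-1 : K) ^ (codeg c * letterDegSum deg (L.filter fun τ ↦ decide (τ < toLex (c, m)))) *
    (-(m : K) * (L.count (toLex (c, m)) : K))

namespace IsHeisenbergRepresentation

/-- **`𝔮₋ₘ(y_c)` super-commutes with every creation letter other than `𝔮ₘ(x_c)`**: for `τ = (c', r) ≠ (c, m)` the
central term `δ_{r,m} (−m) ⟨y_c, x_{c'}⟩ = δ_{r,m} δ_{c,c'} (−m)` vanishes. [cite: LiQinWang2002, Thm. 2.16 (i) and (2.7)
p. 5] [cite: Lehn1999, Thm. 2.5] -/
theorem annihilator_mul_letter_of_ne (h : IsHeisenbergRepresentation B q vac)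
    (hx : ∀ c, x c ∈ LinearMap.range (lof K ℕ A (deg c))) (hy : ∀ c, y c ∈ LinearMap.range (lof K ℕ A (codeg c)))
    (hB : ∀ c c', B (y c) (x c') = if c = c' then 1 else 0) {m : ℕ} (c : Fin N) {τ : Lex (Fin N × ℕ)}
    (hτ : τ ≠ toLex (c, m)) :
    q (-(m : ℤ)) (y c) * q (letterPart τ : ℤ) (x (letterColour τ)) =
      ((-1 : K) ^ (codeg c * deg (letterColour τ))) •
        (q (letterPart τ : ℤ) (x (letterColour τ)) * q (-(m : ℤ)) (y c)) := by
  obtain ⟨a, ha⟩ := hy c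
  obtain ⟨b, hb⟩ := hx (letterColour τ)
  have hbr := h.bracket (-(m : ℤ)) (letterPart τ : ℤ) (codeg c) (deg (letterColour τ)) a b
  rw [ha, hb] at hbr
  by_cases hcond : -(m : ℤ) + (letterPart τ : ℤ) = 0
  · have hcc' : c ≠ letterColour τ := by
      rintro rfl
      apply hτ
      have hm : letterPart τ = m := by omega
      rw [← hm]
      rfl
    rw [if_pos hcond, hB, if_neg hcc', mul_zero, zero_smul] at hbr
    exact sub_eq_zero.1 hbr
  · rw [if_neg hcond] at hbr
    exact sub_eq_zero.1 hbr

/-- **The one non-trivial super-commutator**: `𝔮₋ₘ(y_c) 𝔮ₘ(x_c) ∓ 𝔮ₘ(x_c) 𝔮₋ₘ(y_c) = (−m)·Id` (`⟨y_c, x_c⟩ = 1`).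
[cite: LiQinWang2002, Thm. 2.16 (i) and (2.7) p. 5] [cite: Lehn1999, Thm. 2.5] -/
theorem annihilator_mul_self (h : IsHeisenbergRepresentation B q vac)
    (hx : ∀ c, x c ∈ LinearMap.range (lof K ℕ A (deg c))) (hy : ∀ c, y c ∈ LinearMap.range (lof K ℕ A (codeg c)))
    (hB : ∀ c c', B (y c) (x c') = if c = c' then 1 else 0) (m : ℕ) (c : Fin N) :
    q (-(m : ℤ)) (y c) * q (m : ℤ) (x c) -
        ((-1 : K) ^ (codeg c * deg c)) • (q (m : ℤ) (x c) * q (-(m : ℤ)) (y c)) =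
      (-(m : K)) • (1 : Module.End K (Fock Φ)) := by
  obtain ⟨a, ha⟩ := hy c
  obtain ⟨b, hb⟩ := hx c
  have hbr := h.bracket (-(m : ℤ)) (m : ℤ) (codeg c) (deg c) a b
  rw [ha, hb, if_pos (by omega), hB, if_pos rfl, mul_one, Int.cast_neg, Int.cast_natCast] at hbr
  exact hbr

/-- The same on vectors: `𝔮₋ₘ(y_c)(𝔮ₘ(x_c) w) = (−m)·w ± 𝔮ₘ(x_c)(𝔮₋ₘ(y_c) w)`. [cite: LiQinWang2002, Thm. 2.16 (i)
p. 5] [cite: Lehn1999, Thm. 2.5] -/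
theorem annihilator_apply_q_self_apply (h : IsHeisenbergRepresentation B q vac)
    (hx : ∀ c, x c ∈ LinearMap.range (lof K ℕ A (deg c))) (hy : ∀ c, y c ∈ LinearMap.range (lof K ℕ A (codeg c)))
    (hB : ∀ c c', B (y c) (x c') = if c = c' then 1 else 0) (m : ℕ) (c : Fin N) (w : Fock Φ) :
    q (-(m : ℤ)) (y c) (q (m : ℤ) (x c) w) =
      (-(m : K)) • w + ((-1 : K) ^ (codeg c * deg c)) • q (m : ℤ) (x c) (q (-(m : ℤ)) (y c) w) := by
  have hv := LinearMap.congr_fun (h.annihilator_mul_self hx hy hB m c) w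
  rw [LinearMap.sub_apply, Module.End.mul_apply, LinearMap.smul_apply, Module.End.mul_apply, LinearMap.smul_apply,
    Module.End.one_apply] at hv
  rw [← hv, sub_add_cancel]

/-- In a word all of whose letters are `≥ τ₀ > σ`, or more generally containing no `σ`, … (plumbing): the letters of
an admissible word `τ :: L` are all `≥ τ`. [cite: LiQinWang2003, §6 p. 13] -/
theorem _root_.Literature.AlgebraicGeometry.HilbertScheme.IsAdmissibleWord.le_of_mem_tail {τ : Lex (Fin N × ℕ)}
    {L : List (Lex (Fin N × ℕ))} (hL : IsAdmissibleWord deg (τ :: L)) {l : Lex (Fin N × ℕ)} (hl : l ∈ L) : τ ≤ l :=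
  ((List.pairwise_cons.1 hL.2).1 l hl).1

/-- **`𝔮₋ₘ(y_c)` acts on a sorted admissible monomial as a derivation**: for `m ≥ 1` and `L` sorted admissible,
`𝔮₋ₘ(y_c) · Π_L 𝔮_{rⱼ}(x_{cⱼ})|0⟩ = annCoef · Π_{L ∖ (c,m)} 𝔮|0⟩` — it removes ONE copy of the letter `(c, m)` with the
coefficient `± (−m) · (multiplicity of (c, m))`, in particular gives `0` when the letter does not occur (`𝔮₋ₘ(y)|0⟩ = 0`).
[cite: Lehn1999, Thm. 2.5 and proof of Cor. 2.6 ("we let `W₋` act on `S*W₊` by derivation")] [cite: Nakajima1997, §8] -/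
theorem annihilator_apply_letterMonomial_vac (h : IsHeisenbergRepresentation B q vac)
    (hx : ∀ c, x c ∈ LinearMap.range (lof K ℕ A (deg c))) (hy : ∀ c, y c ∈ LinearMap.range (lof K ℕ A (codeg c)))
    (hB : ∀ c c', B (y c) (x c') = if c = c' then 1 else 0) {m : ℕ} (hm : 1 ≤ m) (c : Fin N) :
    ∀ {L : List (Lex (Fin N × ℕ))}, IsAdmissibleWord deg L →
      q (-(m : ℤ)) (y c) (monomialOp q (letterWord x L) vac) =
        annCoef K deg codeg c m L • monomialOp q (letterWord x (L.erase (toLex (c, m)))) vac := by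
  intro L
  induction L with
  | nil =>
    intro _
    rw [letterWord_nil, monomialOp_nil, Module.End.one_apply, h.q_apply_vac_eq_zero (by omega)]
    simp [annCoef]
  | cons τ L ih =>
    intro hL
    have hL' : IsAdmissibleWord deg L := hL.sublist (List.sublist_cons_self τ L)
    have ihL := ih hL'
    set σ : Lex (Fin N × ℕ) := toLex (c, m) with hσ
    rcases lt_trichotomy τ σ with hlt | heq | hgt
    · -- `τ < σ`: move past `τ` (no central term), then use the induction hypothesis
      have hne : τ ≠ σ := hlt.ne
      have hcoef : annCoef K deg codeg c m (τ :: L) =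
          (-1 : K) ^ (codeg c * deg (letterColour τ)) * annCoef K deg codeg c m L := by
        simp only [annCoef]
        rw [List.filter_cons_of_pos (by simpa using hlt), letterDegSum_cons, List.count_cons_of_ne hne, mul_add, pow_add]
        ring
      rw [letterWord_cons, monomialOp_cons, Module.End.mul_apply, ← Module.End.mul_apply (q _ _),
        h.annihilator_mul_letter_of_ne hx hy hB c hne, LinearMap.smul_apply, Module.End.mul_apply, ihL, map_smul,
        smul_smul, hcoef, List.erase_cons_tail (by simpa using hne), letterWord_cons, monomialOp_cons,
        Module.End.mul_apply]
    · -- `τ = σ`: the central term fires once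
      subst heq
      have hge : ∀ l ∈ L, σ ≤ l := fun l hl ↦ hL.le_of_mem_tail hl
      have hfilterL : L.filter (fun τ ↦ decide (τ < σ)) = [] := by
        rw [List.filter_eq_nil_iff]
        intro l hl
        simpa using hge l hl
      have hcoefL : annCoef K deg codeg c m L = -(m : K) * (L.count σ : K) := by
        simp only [annCoef]
        rw [hfilterL, letterDegSum_nil, mul_zero, pow_zero, one_mul]
      have hcoef : annCoef K deg codeg c m (σ :: L) = -(m : K) * (L.count σ : K) + -(m : K) := by
        simp only [annCoef]
        rw [List.filter_cons_of_neg (by simp [hσ]), hfilterL, letterDegSum_nil, mul_zero, pow_zero, one_mul,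
          List.count_cons_self, Nat.cast_add, Nat.cast_one, mul_add, mul_one]
      rw [List.erase_cons_head, letterWord_cons, monomialOp_cons, Module.End.mul_apply,
        show letterColour σ = c from rfl, show (letterPart σ : ℤ) = (m : ℤ) from rfl,
        h.annihilator_apply_q_self_apply hx hy hB m c, ihL, map_smul, smul_smul, hcoef, add_smul, add_comm]
      congr 1
      -- the second term: either the letter `σ` is absent from `L` (coefficient `0`), or `x_c` is even and `L = σ :: _`
      by_cases hk : L.count σ = 0
      · rw [hcoefL, hk, Nat.cast_zero, mul_zero, mul_zero, zero_smul, zero_smul]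
      · have hmem : σ ∈ L := by
          by_contra hnot
          exact hk (List.count_eq_zero.2 hnot)
        -- `L = σ :: L''`
        obtain ⟨l₀, L'', rfl⟩ : ∃ l₀ L'', L = l₀ :: L'' := by
          cases L with
          | nil => exact (List.not_mem_nil hmem).elim
          | cons l₀ L'' => exact ⟨l₀, L'', rfl⟩
        have hl₀ : l₀ = σ := by
          rcases List.mem_cons.1 hmem with h0 | h0
          · exact h0.symm
          · exact le_antisymm (hL'.le_of_mem_tail h0) (hge l₀ List.mem_cons_self)
        subst hl₀
        -- `x_c` is even (an odd letter is never repeated)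
        have heven : Even (deg c) := by
          have hR := (List.pairwise_cons.1 hL.2).1 _ List.mem_cons_self
          by_contra hodd
          exact hR.2 (Nat.not_even_iff_odd.1 hodd) rfl
        rw [hcoefL, Even.neg_one_pow (heven.mul_left _), one_mul, List.erase_cons_head]
        congr 1
    · -- `τ > σ`: the letter `σ` occurs neither as `τ` nor in `L`; both sides vanish
      have hne : τ ≠ σ := hgt.ne'
      have hnotin : σ ∉ L := fun hl ↦ (lt_irrefl σ) (hgt.trans_le (hL.le_of_mem_tail hl))
      have hkL : L.count σ = 0 := List.count_eq_zero.2 hnotin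
      have hcoefL : annCoef K deg codeg c m L = 0 := by
        simp only [annCoef]
        rw [hkL, Nat.cast_zero, mul_zero, mul_zero]
      have hcoef : annCoef K deg codeg c m (τ :: L) = 0 := by
        simp only [annCoef]
        rw [List.count_cons_of_ne hne, hkL, Nat.cast_zero, mul_zero, mul_zero]
      rw [letterWord_cons, monomialOp_cons, Module.End.mul_apply, ← Module.End.mul_apply (q _ _),
        h.annihilator_mul_letter_of_ne hx hy hB c hne, LinearMap.smul_apply, Module.End.mul_apply, ihL, hcoefL,
        zero_smul, map_zero, smul_zero, hcoef, zero_smul]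

/-- The coefficient is non-zero when the letter occurs (characteristic zero, `m ≥ 1`). [cite: Lehn1999, proof of
Cor. 2.6] -/
theorem annCoef_ne_zero [CharZero K] {c : Fin N} {m : ℕ} (hm : 1 ≤ m) {L : List (Lex (Fin N × ℕ))}
    (hL : toLex (c, m) ∈ L) : annCoef K deg codeg c m L ≠ 0 := by
  have hk : L.count (toLex (c, m)) ≠ 0 := fun h0 ↦ (List.count_eq_zero.1 h0) hL
  simp only [annCoef]
  refine mul_ne_zero (pow_ne_zero _ (neg_ne_zero.2 one_ne_zero)) (mul_ne_zero ?_ ?_)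
  · exact neg_ne_zero.2 (by exact_mod_cast (show m ≠ 0 by omega))
  · exact_mod_cast hk

/-! ### 2. Linear independence of the sorted admissible monomials -/

/-- A sorted word is determined by its erasure of a letter it contains. [cite: LiQinWang2003, §6 p. 13] -/
theorem _root_.Literature.AlgebraicGeometry.HilbertScheme.IsAdmissibleWord.eq_of_erase_eq {σ : Lex (Fin N × ℕ)}
    {L₁ L₂ : List (Lex (Fin N × ℕ))} (h₁ : IsAdmissibleWord deg L₁) (h₂ : IsAdmissibleWord deg L₂) (hσ₁ : σ ∈ L₁)
    (hσ₂ : σ ∈ L₂) (he : L₁.erase σ = L₂.erase σ) : L₁ = L₂ := by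
  refine List.Perm.eq_of_pairwise' h₁.pairwise_le h₂.pairwise_le ?_
  exact (List.perm_cons_erase hσ₁).trans (by rw [he]; exact (List.perm_cons_erase hσ₂).symm)

/-- The total mode drops by `m` when the letter `(c, m)` is erased. [cite: LiQinWang2003, §6 p. 13] -/
theorem _root_.Literature.AlgebraicGeometry.HilbertScheme.wordMode_letterWord_erase (x : Fin N → ⨁ i, A i)
    {σ : Lex (Fin N × ℕ)} {L : List (Lex (Fin N × ℕ))} (hσ : σ ∈ L) :
    wordMode (letterWord x (L.erase σ)) + letterPart σ = wordMode (letterWord x L) := by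
  rw [wordMode_letterWord, wordMode_letterWord, ((List.perm_cons_erase hσ).map letterPart).sum_eq, List.map_cons,
    List.sum_cons, add_comm]

/-- **The sorted admissible monomials `Π_L 𝔮|0⟩` are linearly independent** (all total modes at once), for a
representation over a field of characteristic zero with a homogeneous dual family `y` to `x`: a non-trivial relation
has a word `L₀ ≠ []` with non-zero coefficient (the empty word alone gives `g·|0⟩ = 0 ⇒ g = 0`); applying `𝔮₋ₘ(y_c)`
for a letter `(c, m)` of `L₀` produces a relation among words of smaller total mode in which the coefficient of
`L₀ ∖ (c, m)` is `g(L₀) · annCoef ≠ 0` — induction on the maximal total mode. [cite: Lehn1999, Cor. 2.6 and proof]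
[cite: LiQinWang2003, §6 pp. 13–14] [cite: Nakajima1997, Thm. 1.2 / §8] -/
theorem linearIndependent_letterMonomial_vac [CharZero K] (h : IsHeisenbergRepresentation B q vac)
    (hx : ∀ c, x c ∈ LinearMap.range (lof K ℕ A (deg c))) (hy : ∀ c, y c ∈ LinearMap.range (lof K ℕ A (codeg c)))
    (hB : ∀ c c', B (y c) (x c') = if c = c' then 1 else 0) :
    LinearIndependent K (fun L : {L : List (Lex (Fin N × ℕ)) // IsAdmissibleWord deg L} ↦
      monomialOp q (letterWord x L.1) vac) := by
  classical
  rw [linearIndependent_iff']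
  -- induction on a bound `W` for the total modes of the words in the relation
  suffices key : ∀ (W : ℕ) (s : Finset {L : List (Lex (Fin N × ℕ)) // IsAdmissibleWord deg L}),
      (∀ L ∈ s, wordMode (letterWord x L.1) ≤ W) → ∀ g : {L : List (Lex (Fin N × ℕ)) // IsAdmissibleWord deg L} → K,
        ∑ L ∈ s, g L • monomialOp q (letterWord x L.1) vac = 0 → ∀ L ∈ s, g L = 0 from
    fun s g hg L hL ↦ key (s.sup fun L ↦ wordMode (letterWord x L.1)) s
      (fun L hL ↦ Finset.le_sup (f := fun L ↦ wordMode (letterWord x L.1)) hL) g hg L hL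
  intro W
  induction W using Nat.strong_induction_on with
  | _ W IH =>
  intro s hW g hrel
  by_contra hcontra
  push Not at hcontra
  -- is there a NON-EMPTY word with non-zero coefficient?
  by_cases hne : ∃ L ∈ s, g L ≠ 0 ∧ L.1 ≠ []
  · obtain ⟨L₀, hL₀s, hg₀, hL₀⟩ := hne
    obtain ⟨σ, hσ⟩ := List.exists_mem_of_ne_nil L₀.1 hL₀
    set c := letterColour σ with hc
    set m := letterPart σ with hm
    have hσcm : toLex (c, m) = σ := rfl
    have hm1 : 1 ≤ m := L₀.2.1 σ hσ
    -- the erasure map and the relation obtained by applying `𝔮₋ₘ(y_c)`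
    let er : {L : List (Lex (Fin N × ℕ)) // IsAdmissibleWord deg L} → {L : List (Lex (Fin N × ℕ)) // IsAdmissibleWord deg L} :=
      fun L ↦ ⟨L.1.erase σ, L.2.sublist List.erase_sublist⟩
    let s₁ := s.filter fun L ↦ σ ∈ L.1
    have hrel₁ : ∑ L ∈ s₁, (g L * annCoef K deg codeg c m L.1) • monomialOp q (letterWord x (er L).1) vac = 0 := by
      have happ := congrArg (q (-(m : ℤ)) (y c)) hrel
      rw [map_sum, map_zero] at happ
      rw [← happ, Finset.sum_filter]
      refine Finset.sum_congr rfl fun L _ ↦ ?_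
      rw [map_smul, h.annihilator_apply_letterMonomial_vac hx hy hB hm1 c L.2, smul_smul, hσcm]
      split_ifs with hσL
      · rfl
      · have h0 : annCoef K deg codeg c m L.1 = 0 := by
          simp only [annCoef]
          rw [hσcm, List.count_eq_zero.2 hσL, Nat.cast_zero, mul_zero, mul_zero]
        rw [h0, mul_zero, zero_smul]
    -- regroup along the fibres of `er` on `s₁`
    let t := s₁.image er
    let g' : {L : List (Lex (Fin N × ℕ)) // IsAdmissibleWord deg L} → K :=
      fun L' ↦ ∑ L ∈ s₁.filter (fun L ↦ er L = L'), g L * annCoef K deg codeg c m L.1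
    have hrel' : ∑ L' ∈ t, g' L' • monomialOp q (letterWord x L'.1) vac = 0 := by
      rw [← hrel₁, ← Finset.sum_fiberwise_of_maps_to (s := s₁) (t := t) (g := er)
        (fun L hL ↦ Finset.mem_image_of_mem er hL)]
      refine Finset.sum_congr rfl fun L' _ ↦ ?_
      rw [Finset.sum_smul]
      refine Finset.sum_congr rfl fun L hL ↦ ?_
      rw [(Finset.mem_filter.1 hL).2]
    -- the new words have total mode `≤ W - m < W`
    have hWm : m ≤ W := by
      have := hW L₀ hL₀s
      have h2 := letterPart_le_wordMode x hσ
      omega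
    have hW' : ∀ L' ∈ t, wordMode (letterWord x L'.1) ≤ W - m := by
      intro L' hL'
      obtain ⟨L, hL, rfl⟩ := Finset.mem_image.1 hL'
      have hσL : σ ∈ L.1 := (Finset.mem_filter.1 hL).2
      have h1 := wordMode_letterWord_erase x hσL
      have h2 := hW L (Finset.mem_filter.1 hL).1
      change wordMode (letterWord x (L.1.erase σ)) ≤ W - m
      omega
    have hzero := IH (W - m) (by omega) t hW' g' hrel' (er L₀)
      (Finset.mem_image_of_mem er (Finset.mem_filter.2 ⟨hL₀s, hσ⟩))
    -- the fibre of `er L₀` in `s₁` is `{L₀}`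
    have hfib : s₁.filter (fun L ↦ er L = er L₀) = {L₀} := by
      ext L
      simp only [Finset.mem_filter, Finset.mem_singleton]
      constructor
      · rintro ⟨hL, hEq⟩
        have hσL : σ ∈ L.1 := (Finset.mem_filter.1 hL).2
        exact Subtype.ext (L.2.eq_of_erase_eq L₀.2 hσL hσ (congrArg Subtype.val hEq))
      · rintro rfl
        exact ⟨Finset.mem_filter.2 ⟨hL₀s, hσ⟩, rfl⟩
    have : g L₀ * annCoef K deg codeg c m L₀.1 = 0 := by
      have hg' : g' (er L₀) = 0 := hzero
      simp only [g'] at hg'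
      rwa [hfib, Finset.sum_singleton] at hg'
    rcases mul_eq_zero.1 this with h0 | h0
    · exact hg₀ h0
    · exact annCoef_ne_zero hm1 (hσcm ▸ hσ) h0
  · -- every word with non-zero coefficient is empty: the relation reads `g(∅) · |0⟩ = 0`
    push Not at hne
    obtain ⟨L₀, hL₀s, hg₀⟩ := hcontra
    have hL₀ : L₀.1 = [] := hne L₀ hL₀s hg₀
    have hsum : ∑ L ∈ s, g L • monomialOp q (letterWord x L.1) vac = g L₀ • vac := by
      rw [Finset.sum_eq_single_of_mem L₀ hL₀s]
      · rw [hL₀, letterWord_nil, monomialOp_nil, Module.End.one_apply]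
      · intro L hL hLne
        by_cases hgL : g L = 0
        · rw [hgL, zero_smul]
        · exact (hLne (Subtype.ext (by rw [hne L hL hgL, hL₀]))).elim
    rw [hsum] at hrel
    exact hg₀ ((smul_eq_zero.1 hrel).resolve_right h.vac_ne_zero)

/-! ### 3. Re-indexing by partition-valued functions -/

/-- The canonical list of `ρ ∈ 𝒫ₙ` is a sorted admissible word (parts `≥ 1` as `ρ c 0 = 0`; odd colours not repeated
as `ρ c r ≤ 1`). [cite: LiQinWang2003, §6 p. 13] -/
theorem _root_.Literature.AlgebraicGeometry.HilbertScheme.isAdmissibleWord_canonList {n : ℕ}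
    {ρ : Fin N → Fin (n + 1) → ℕ} (hρ : IsPartitionValued deg n ρ) : IsAdmissibleWord deg (canonList n ρ) := by
  classical
  have hmem : ∀ τ ∈ canonList n ρ, ∃ c, ∃ r : Fin (n + 1), ρ c r ≠ 0 ∧ τ = toLex (c, (r : ℕ)) := by
    intro τ hτ
    simp only [canonList, List.mem_flatMap, List.mem_replicate, List.mem_finRange, true_and] at hτ
    obtain ⟨c, r, hk, rfl⟩ := hτ
    exact ⟨c, r, hk, rfl⟩
  refine ⟨fun τ hτ ↦ ?_, ?_⟩
  · obtain ⟨c, r, hk, rfl⟩ := hmem τ hτ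
    rw [letterPart_toLex]
    by_contra h0
    have hr : r = 0 := Fin.ext (by simp only [Fin.val_zero]; omega)
    exact hk (hr ▸ hρ.1 c)
  · rw [List.pairwise_iff_forall_sublist]
    intro a b hab
    refine ⟨(pairwise_le_canonList n ρ).sublist hab |> List.pairwise_pair.1, fun hodd heq ↦ ?_⟩
    subst heq
    obtain ⟨c, r, -, rfl⟩ := hmem a (hab.subset List.mem_cons_self)
    have h2 : 2 ≤ (canonList n ρ).count (toLex (c, (r : ℕ))) :=
      (List.replicate_sublist_iff (n := 2) (a := toLex (c, (r : ℕ)))).1 hab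
    rw [count_canonList, dif_pos (Nat.le_of_lt_succ r.2), Fin.eta] at h2
    have h1 := hρ.2.1 c r (by simpa using hodd)
    omega

/-- The counts of the canonical list of `ρ` are `ρ`. [cite: LiQinWang2003, §6 p. 13] -/
theorem _root_.Literature.AlgebraicGeometry.HilbertScheme.countFn_canonList {n : ℕ} (ρ : Fin N → Fin (n + 1) → ℕ) :
    countFn n (canonList n ρ) = ρ := by
  classical
  funext c r
  show (canonList n ρ).count (toLex (c, (r : ℕ))) = ρ c r
  rw [count_canonList, dif_pos (Nat.le_of_lt_succ r.2), Fin.eta]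

/-- **The Heisenberg monomials `Π_c 𝔞_{−ρ(c)}(x_c)|0⟩`, `ρ ∈ 𝒫ₙ`, are linearly independent** (generic form: any
representation satisfying the axioms over a field of characteristic zero, with a homogeneous dual family `y` to `x`).
[cite: LiQinWang2003, §6 pp. 13–14] [cite: Nakajima1997, Thm. 1.2 / §8] [cite: Lehn1999, Cor. 2.6] -/
theorem linearIndependent_heisenbergMonomial [CharZero K] (h : IsHeisenbergRepresentation B q vac)
    (hx : ∀ c, x c ∈ LinearMap.range (lof K ℕ A (deg c))) (hy : ∀ c, y c ∈ LinearMap.range (lof K ℕ A (codeg c)))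
    (hB : ∀ c c', B (y c) (x c') = if c = c' then 1 else 0) (n : ℕ) :
    LinearIndependent K (fun ρ : {ρ : Fin N → Fin (n + 1) → ℕ // IsPartitionValued deg n ρ} ↦
      heisenbergMonomial q vac x n ρ.1) := by
  let Ψ : {ρ : Fin N → Fin (n + 1) → ℕ // IsPartitionValued deg n ρ} →
      {L : List (Lex (Fin N × ℕ)) // IsAdmissibleWord deg L} :=
    fun ρ ↦ ⟨canonList n ρ.1, isAdmissibleWord_canonList ρ.2⟩
  have hΨ : Function.Injective Ψ := by
    intro ρ ρ' hρρ'
    apply Subtype.ext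
    have := congrArg (fun L : {L : List (Lex (Fin N × ℕ)) // IsAdmissibleWord deg L} ↦ countFn n L.1) hρρ'
    simpa [Ψ, countFn_canonList] using this
  have hcomp : (fun ρ : {ρ : Fin N → Fin (n + 1) → ℕ // IsPartitionValued deg n ρ} ↦
      heisenbergMonomial q vac x n ρ.1) =
      (fun L : {L : List (Lex (Fin N × ℕ)) // IsAdmissibleWord deg L} ↦ monomialOp q (letterWord x L.1) vac) ∘ Ψ := by
    funext ρ
    simp only [Function.comp_apply, Ψ, heisenbergMonomial, letterWord_canonList]
  rw [hcomp]
  exact (h.linearIndependent_letterMonomial_vac hx hy hB).comp Ψ hΨ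

end IsHeisenbergRepresentation

end Annihilation

/-! ### 4. A Casimir element represents functionals on the left -/

section Casimir

variable {K : Type u} [Field K] {V : Type v} [AddCommGroup V] [Module K V]

/-- **A Casimir element `C = Σᵢ eᵢ ⊗ εᵢ` of `B` (`Σᵢ ⟨eᵢ, v⟩ εᵢ = v`) represents every linear functional on the left**:
for `φ ∈ V^*` the vector `u = Σᵢ φ(εᵢ) eᵢ` has `⟨u, v⟩ = φ(v)` for all `v` (apply `φ` to the Casimir identity).
[cite: Lehn1999, §3.1 p. 8 (the adjoint of the cup product)] -/
theorem IsCasimir.exists_left_dual {B : V →ₗ[K] V →ₗ[K] K} {C : V ⊗[K] V} (hC : IsCasimir K B C)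
    (φ : Module.Dual K V) : ∃ u : V, ∀ v, B u v = φ v := by
  refine ⟨TensorProduct.lift (((LinearMap.lsmul K V).flip).compl₂ φ) C, fun v ↦ ?_⟩
  have key : ∀ C' : V ⊗[K] V, B (TensorProduct.lift (((LinearMap.lsmul K V).flip).compl₂ φ) C') v =
      φ (TensorProduct.lift ((LinearMap.lsmul K V).comp (B.flip v)) C') := by
    intro C'
    induction C' using TensorProduct.induction_on with
    | zero => simp
    | tmul e ε => simp [mul_comm]
    | add C₁ C₂ h₁ h₂ => simp only [map_add, LinearMap.add_apply, h₁, h₂]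
  rw [key, hC v]

end Casimir

/-! ### 5. On the tree's carriers: the dual family from Poincaré duality, and the discharge -/

section Geometric

open Literature.AlgebraicGeometry.Motives (SchemeOver ComplexPoints IsSmoothProjective)
open Literature.AlgebraicGeometry.Hyperkaehler (totalCohomology ofDegree)
open Literature.AlgebraicGeometry.HodgeTheory (complexBetti)

variable {S : SchemeOver ℂ} {hS : IsSmoothProjective 2 S} {H : HilbertSchemesOfPoints S}

/-- **A homogeneous basis of `H*(S(ℂ); ℂ)` has a homogeneous dual family for the Poincaré pairing**: for `x_c ∈ H^{d_c}`
linearly independent and spanning there are `y_c ∈ H^{4 − d_c}` with `∫_S y_c ∪ x_{c'} = δ_{cc'}` (Poincaré duality,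
via the Casimir element of `PoincareCasimirElement` and the orthogonality of non-complementary degrees).
[cite: Lehn1999, §3.1 p. 8] [cite: HatcherAT2002, §3.3 Prop. 3.38] -/
theorem exists_homogeneous_dual_family (hS : IsSmoothProjective 2 S) {N : ℕ}
    {x : Fin N → totalCohomology ℂ (ComplexPoints S)} {deg : Fin N → ℕ}
    (hdeg : ∀ c, x c ∈ LinearMap.range (ofDegree ℂ (ComplexPoints S) (deg c))) (hli : LinearIndependent ℂ x)
    (hsp : Submodule.span ℂ (Set.range x) = ⊤) :
    ∃ y : Fin N → totalCohomology ℂ (ComplexPoints S),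
      (∀ c, y c ∈ LinearMap.range (ofDegree ℂ (ComplexPoints S) (4 - deg c))) ∧
        ∀ c c', poincarePairing hS (y c) (x c') = if c = c' then 1 else 0 := by
  classical
  obtain ⟨C, -, hC⟩ := exists_isCasimir_mem_evenTensorSpan hS
  let b : Module.Basis (Fin N) ℂ (totalCohomology ℂ (ComplexPoints S)) := Module.Basis.mk hli hsp.ge
  -- a (possibly inhomogeneous) left dual `u c` of the coordinate functional of `x_c`
  have hu : ∀ c, ∃ u : totalCohomology ℂ (ComplexPoints S), ∀ v, poincarePairing hS u v = b.coord c v :=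
    fun c ↦ hC.exists_left_dual (b.coord c)
  choose u hu using hu
  have hux : ∀ c c', poincarePairing hS (u c) (x c') = if c = c' then 1 else 0 := by
    intro c c'
    rw [hu, show x c' = b c' by rw [Module.Basis.coe_mk], Module.Basis.coord_apply, b.repr_self,
      Finsupp.single_apply]
    rcases eq_or_ne c c' with rfl | hne
    · rw [if_pos rfl]
    · rw [if_neg hne, if_neg (Ne.symm hne)]
  -- every `deg c ≤ 4` (otherwise `x_c ∈ H^{>4} = 0`)
  choose a ha using hdeg
  have hdeg4 : ∀ c, deg c ≤ 4 := by
    intro c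
    by_contra hlt
    haveI := Motives.ComplexPoints.subsingleton_singularCohomology_of_lt hS ℂ (k := deg c) (by omega)
    apply hli.ne_zero c
    rw [← ha c, Subsingleton.elim (a c) 0, map_zero]
  -- `⟨w, x_{c'}⟩` only sees the component of `w` of degree `4 - deg c'`
  have hcomp : ∀ (w : totalCohomology ℂ (ComplexPoints S)) (c' : Fin N),
      poincarePairing hS w (x c') = poincarePairing hS
        (ofDegree ℂ (ComplexPoints S) (4 - deg c') (DirectSum.component ℂ ℕ _ (4 - deg c') w)) (x c') := by
    intro w c'
    rw [← ha c']
    induction w using DirectSum.induction_on with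
    | zero => simp only [map_zero, LinearMap.zero_apply]
    | of j b =>
      rw [← DirectSum.lof_eq_of ℂ]
      by_cases hj : j = 4 - deg c'
      · subst hj
        rw [DirectSum.component.lof_self]
      · rw [DirectSum.component.of, dif_neg hj, map_zero, map_zero, LinearMap.zero_apply]
        exact poincarePairing_ofDegree_of_ne hS (by have := hdeg4 c'; omega) _ _
    | add w₁ w₂ h₁ h₂ => simp only [map_add, LinearMap.add_apply, h₁, h₂]
  -- the homogeneous component of `u c` of degree `4 - deg c`
  refine ⟨fun c ↦ ofDegree ℂ (ComplexPoints S) (4 - deg c) (DirectSum.component ℂ ℕ _ (4 - deg c) (u c)),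
    fun c ↦ ⟨_, rfl⟩, fun c c' ↦ ?_⟩
  beta_reduce
  by_cases hcc : deg c = deg c'
  · rw [← hux c c', hcomp (u c) c', hcc]
  · have hne : c ≠ c' := fun h ↦ hcc (h ▸ rfl)
    rw [if_neg hne, ← ha c']
    exact poincarePairing_ofDegree_of_ne hS (by have := hdeg4 c; have := hdeg4 c'; omega) _ _

/-- **Nakajima–Grojnowski, independence half, PROVED on the tree's interface**: for Nakajima operators `𝔑` of a
choice `H` of Hilbert schemes of a smooth projective surface `S`, a homogeneous basis `x` of `H*(S(ℂ); ℂ)` and every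
`n`, the Heisenberg monomials `Π_c 𝔞_{−ρ(c)}(x_c)|0⟩`, `ρ ∈ 𝒫ₙ`, are linearly independent.
[cite: LiQinWang2003, §6 pp. 13–14] [cite: Nakajima1997, Thm. 1.2 / §8] [cite: Grojnowski1996, Thm. 1]
[cite: Lehn1999, Cor. 2.6] -/
theorem NakajimaOperators.linearIndependent_heisenbergMonomial (𝔑 : NakajimaOperators hS H) {N : ℕ}
    {x : Fin N → totalCohomology ℂ (ComplexPoints S)} {deg : Fin N → ℕ}
    (hdeg : ∀ c, x c ∈ LinearMap.range (ofDegree ℂ (ComplexPoints S) (deg c))) (hli : LinearIndependent ℂ x)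
    (hsp : Submodule.span ℂ (Set.range x) = ⊤) (n : ℕ) :
    LinearIndependent ℂ (fun ρ : {ρ : Fin N → Fin (n + 1) → ℕ // IsPartitionValued deg n ρ} ↦
      heisenbergMonomial 𝔑.q (vacuumVector H) x n ρ.1) := by
  obtain ⟨y, hy, hB⟩ := exists_homogeneous_dual_family hS hdeg hli hsp
  exact 𝔑.isHeisenberg.linearIndependent_heisenbergMonomial (codeg := fun c ↦ 4 - deg c) hdeg hy hB n

/-- **Nakajima–Grojnowski on the tree's interface, both halves**: the Heisenberg monomials indexed by `𝒫ₙ` are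
linearly independent and span `ℍₙ = H*(S^[n](ℂ); ℂ)`. [cite: LiQinWang2003, §6 pp. 13–14] [cite: Nakajima1997,
Thm. 1.2 / §8] [cite: Grojnowski1996, Thm. 1] [cite: Lehn1999, Cor. 2.6] -/
theorem NakajimaOperators.heisenbergMonomial_basis (𝔑 : NakajimaOperators hS H) {N : ℕ}
    {x : Fin N → totalCohomology ℂ (ComplexPoints S)} {deg : Fin N → ℕ}
    (hdeg : ∀ c, x c ∈ LinearMap.range (ofDegree ℂ (ComplexPoints S) (deg c))) (hli : LinearIndependent ℂ x)
    (hsp : Submodule.span ℂ (Set.range x) = ⊤) (n : ℕ) :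
    LinearIndependent ℂ (fun ρ : {ρ : Fin N → Fin (n + 1) → ℕ // IsPartitionValued deg n ρ} ↦
        heisenbergMonomial 𝔑.q (vacuumVector H) x n ρ.1) ∧
      Submodule.span ℂ (Set.range fun ρ : {ρ : Fin N → Fin (n + 1) → ℕ // IsPartitionValued deg n ρ} ↦
          heisenbergMonomial 𝔑.q (vacuumVector H) x n ρ.1) =
        LinearMap.range (Fock.ofSummand ℂ (fockFamily H) n) :=
  ⟨𝔑.linearIndependent_heisenbergMonomial hdeg hli hsp n, 𝔑.span_heisenbergMonomial_eq_range hdeg hsp n⟩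

/-- **DISCHARGE of the named fact `Nakajima1997_heisenbergMonomialBasis`** (file `HeisenbergMonomialBasis`): the
Nakajima–Grojnowski basis theorem in Li–Qin–Wang's indexing holds for every instance of the tree's interface, by
Lehn's argument from the Heisenberg relations, cyclicity and Poincaré duality (this file and
`HeisenbergMonomialSpanning`). [cite: LiQinWang2003, §6 pp. 13–14] [cite: Nakajima1997, Thm. 1.2 / §8]
[cite: Grojnowski1996, Thm. 1] [cite: Lehn1999, Cor. 2.6] -/
theorem Nakajima1997_heisenbergMonomialBasis_holds : Nakajima1997_heisenbergMonomialBasis :=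
  fun _ _ _ 𝔑 _ _ _ hdeg hli hsp n ↦ 𝔑.heisenbergMonomial_basis hdeg hli hsp n

end Geometric

end Literature.AlgebraicGeometry.HilbertScheme

end
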